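import Summits.BirchSwinnertonDyer.BirchSwinnertonDyer.Theorems.PrintX10bHowardSettingSatisfiesHERed
import Literature.NumberTheory.EllipticCurves.ZpExtensionEisensteinDVRSettingH4BadPlacesUniformProofs
import Literature.NumberTheory.EllipticCurves.ZpExtensionEisensteinDVRSettingH4OrdinaryProofs
import Literature.NumberTheory.EllipticCurves.ZpExtensionEisensteinDVRSettingH4OrdinaryIsotropyProofs
import Literature.NumberTheory.EllipticCurves.AnticyclotomicHeegnerPlacesDecompositionProofs
import Literature.NumberTheory.EllipticCurves.ZpExtensionEisensteinBadSetProofs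
import Literature.NumberTheory.EllipticCurves.ZpExtensionEisensteinKolyvaginPrimesDepthProofs
import Literature.NumberTheory.EllipticCurves.LambdaAdicSelmerDataToEisensteinH1Linear
import Summits.BirchSwinnertonDyer.BirchSwinnertonDyer.Theorems.PrintX9MuPartStabilizedCoherentPairOfCyclic
import HarnessLib

/-!
# D1 ASSEMBLY of STUB A (`stub_howardInputs`) of the shared μ-crux `MuInequalityCoherentPair`
# (stmt-BirchSwinnertonDyer-22642, skeleton v3/v4 of line `spec_witnesses`) — LEAD `bsd-line-x10b-p1` g8

PLANNING ARTEFACT (crux workfile; `sorry`-free).  v3 (LEAD g8, 21:4xZ): `he_red` binder added to INPUTS 2/3; INPUT 2′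
`Stmt.exactAtP` + `h4AtS_of_exactAtP` (H.4 reduced to (Exact) at v ∣ p by the landed p667328/p667675/p669585/p670038); `howardInputs_of_exactAtP`.  The letter `Stmt.howardInputs` of the registered skeleton
(`Cruxes/MuInequalityCoherentPair/Lines/spec_witnesses.lean`, copied VERBATIM below together with `ctrlLevel`, because crux
workfiles are not importable on the farm) is DERIVED from exactly four named inputs:
* `Stmt.poitouTate` — the tree's Poitou–Tate named fact `poitouTate_selmerStructure_duality K` (Milne I 2.6/4.10(b); binder);
* `Stmt.h4AtS` — Howard's H.4 at the finitely many places `v ∈ S` (S = places above `p` ∪ bad places of `E_K`, the canonical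
  set of `exists_sigmaStable_badFinset`) for the instantiated H.4 data `D` of `exists_eisensteinDualityData_unitTwist`
  (canonical conjugation datum `ofLifts σ … (e c₀ e⁻¹) …`), for `m ≫ 0` depending on `S` only — OWNERS: x9-p1-w4 g5
  ((hB)/(Adj)/(Perf)/(Dual), v ∈ S∖{p} torsion case via (N1)), x9-p1-w2 g7 ((hQ)/(T)), (Ker) open, (Exact-count) at v ∣ p LEAD g8,
  final instantiation D1;
* `Stmt.h5bAtS` — Howard's H.5(b) at the places `v ∈ S` for the same data — OWNER x9-p1-w3 g5 ((G-S) plan; v ∣ p via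
  x10b-p1-w5's `torsionMap_delta_apply_mem_torsionFilAt`);
* `Stmt.ksLink` — the Kolyvagin system on the levels-tame Eisenstein setting with bottom class the image of the stabilised class
  (nonzero), for `m ≫ 0`, choosing the pins `π`, the prime set `𝓛` (with the `LargePrimes` witness `𝓛_{s₁}(T_𝔮) ∖ S ⊆ 𝓛`), the
  tower pin `(t, ht, I)` and `jbar′` — OWNERS: x9-p2 g4 (the ONE `Hom`), lit g33 ((F-411) tranche 5), μ-LEAD (`ofHom`/`reindex`),
  x10b-p1-w2 lineage (`κ.one ≠ 0`);
by **`howardInputs_of_clauses`** — the `obtain` chain: (S, π, 𝓛, t, I, jbar′) ← `ksLink` ((F-411)'s `S = placesDividing K (pN)`);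
(c₀, σ, D, hy) ← `exists_eisensteinSettingData_satisfiesH_of_thm413Hypotheses` (p-HY-FRAMES) fed with `h4AtS`/`h5bAtS`;
`LargePrimes` ← `eisensteinDVRSetting_largePrimes` (p652741); κKS ← `ksLink` at `hy`.
No summit statement is proved; the μ-item is NOT asserted; BSD is not proved by any of this.
-/

set_option linter.dupNamespace false
set_option autoImplicit false

noncomputable section

open scoped Classical Pointwise ContRepresentation TensorProduct NumberField

open Function NumberField IsDedekindDomain Field
open Literature Literature.NumberTheory.EllipticCurves WeierstrassCurve
open Literature.NumberTheory.GaloisCohomology Literature.NumberTheory.GaloisCohomology.Howard2004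
open Literature.NumberTheory.GaloisRepresentations Literature.NumberTheory.GaloisRepresentations.DiscreteGaloisModule
open Literature.NumberTheory.Automorphic
open Literature.NumberTheory.EllipticCurves.ZpExtension (EisensteinLevel)
open Summit.BirchSwinnertonDyer.BirchSwinnertonDyer.Theorems

namespace Summit.BirchSwinnertonDyer.BirchSwinnertonDyer.Cruxes.MuInequalityCoherentPair.D1Assembly

/-- VERBATIM copy of `SpecWitnesses.ctrlLevel` (skeleton v3): the level-`k` component of the compact control map at `z`. -/
def ctrlLevel {K : Type} [Field K] [NumberField K] {p : ℕ} [Fact p.Prime] (V : WeierstrassCurve K) [V.IsElliptic]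
    (κ : ZpExtension K p) (γ : Field.absoluteGaloisGroup K) {m : ℕ} (hm : 1 ≤ m)
    (t : ∀ k, (V.torsionGaloisModule ((p : ℤ) ^ (k + 1))).toContRepresentation →ⁱL
      (V.torsionGaloisModule ((p : ℤ) ^ k)).toContRepresentation)
    (ht : ∀ k (P : geomTorsion V ((p : ℤ) ^ (k + 1))), t k P = V.geomTorsionReduce p k P)
    (I : ZpExtension.EisensteinH1Data (κ.unitTwist (-1)) (fun k ↦ V.torsionGaloisModule ((p : ℤ) ^ k)) t hm)
    (D : V.LambdaAdicSelmerData κ γ) (hγ : κ.IsTopGenerator γ)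
    (hE : ∀ P : V.toAffine.Point, p • P = 0 → P = 0) (z : D.S) (k : ℕ) :
    galoisCohomology ((κ.unitTwist (-1)).eisensteinTwist (V.torsionGaloisModule ((p : ℤ) ^ (k + 1))) hm (k + 1)) 1 :=
  I.proj (k + 1) (D.toEisensteinH1Linear hm t ht I hγ hE z)

set_option synthInstance.maxHeartbeats 80000 in
/-- VERBATIM copy of the letter `SpecWitnesses.Stmt.howardInputs` (skeleton v3/v4 STUB A). -/
abbrev Stmt.howardInputs : Prop :=
  ∀ (N : ℕ) [NeZero N] (W : WeierstrassCurve ℚ) [W.IsGloballyMinimal] (K : Type) [Field K] [NumberField K]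
    (p : ℕ) [Fact p.Prime] (κ : ZpExtension K p) (γ : Field.absoluteGaloisGroup K)
    (jbar : AlgebraicClosure K →+* ℂ) (hyp : CastellaGrossiLeeSkinner2022.Thm413Hypotheses N W K p κ γ),
    ¬ W.HasCM → W.HasIrreducibleModPGaloisRep p → (W.baseChange K).HasIrreducibleModPGaloisRep p →
    MastellaZerman2026.HasPadicScalarImage W p → SatisfiesHeegnerHypothesis p K →
    p ∣ NumberField.classNumber K →
    ∀ (D : (W.baseChange K).LambdaAdicSelmerData κ γ)
      (C : CastellaGrossiLeeSkinner2022.StabilizedHeegnerData N W K κ jbar)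
      (X : (W.baseChange K).SelmerDualData κ γ) (z : D.S),
    (∀ (k : ℕ) (hk : C.depth < k), D.proj k z ∈ CastellaGrossiLeeSkinner2022.stabilizedClassLayer C k hk) →
    CastellaGrossiLeeSkinner2022.stabilizedHeegnerModule D C = Submodule.span (IwasawaAlgebra p) {z} →
    Module.Finite (IwasawaAlgebra p) D.S → Module.Finite (IwasawaAlgebra p) X.X →
    Module.IsTorsion (IwasawaAlgebra p) (D.S ⧸ CastellaGrossiLeeSkinner2022.stabilizedHeegnerModule D C) →
    ∃ m₀ : ℕ, ∀ (m : ℕ) (hm : 1 ≤ m), m₀ ≤ m →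
      haveI := hyp.isElliptic
      letI := IwasawaAlgebra.isDomain_quotient_X_pow_add_C p hm
      letI := IwasawaAlgebra.isDiscreteValuationRing_quotient_X_pow_add_C p hm
      haveI := IwasawaAlgebra.EisensteinCoeff.isLocalRing_succ p hm
      letI := IwasawaAlgebra.EisensteinCoeff.algebraOfSpecSucc p m
      haveI := W.isScalarTower_algebraOfSpecSucc (K := K) (p := p) (m := m)
      letI := W.residueModuleSucc (K := K) (p := p) hm
      ∃ (S : Finset (IsDedekindDomain.HeightOneSpectrum (NumberField.RingOfIntegers K)))
        (hpS : ∀ v, ((p : ℕ) : NumberField.RingOfIntegers K) ∈ v.asIdeal → v ∈ S)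
        (hbad : ∀ v, v ∉ S → ((p : ℕ) : NumberField.RingOfIntegers K) ∉ v.asIdeal →
          (W.baseChange K).HasGoodReductionAt v)
        (L : Set (IsDedekindDomain.HeightOneSpectrum (NumberField.RingOfIntegers K)))
        (hL : L ⊆ (W.eisensteinTower (κ.unitTwist (-1)) hm).degreeTwoPrimes p)
        (hLS : ∀ v ∈ L, v ∉ S) (jbar' : AlgebraicClosure K →+* ℂ) (cd : ConjugationDatum K)
        (Dd : ∀ k, DualityDatum p cd ((W.eisensteinTower (κ.unitTwist (-1)) hm).ρ k)
          (IwasawaAlgebra.EisensteinCoeff p m (k + 1)))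
        (fs : ∀ (k : ℕ) (n : Finset (IsDedekindDomain.HeightOneSpectrum (NumberField.RingOfIntegers K)))
          (v : IsDedekindDomain.HeightOneSpectrum (NumberField.RingOfIntegers K)),
          galoisCohomology ((W.eisensteinLevelQuot (κ.unitTwist (-1)) hm k n).toLocal (Sum.inr v)) 1 →+
            SingularQuotient (GaloisRep.toLocal v (W.eisensteinLevelQuot (κ.unitTwist (-1)) hm k n)) ⊗[ℤ]
              Gell v)
        (t : ∀ k, ((W.baseChange K).torsionGaloisModule ((p : ℤ) ^ (k + 1))).toContRepresentation →ⁱL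
          ((W.baseChange K).torsionGaloisModule ((p : ℤ) ^ k)).toContRepresentation)
        (ht : ∀ k (P : geomTorsion (W.baseChange K) ((p : ℤ) ^ (k + 1))),
          t k P = (W.baseChange K).geomTorsionReduce p k P)
        (I : ZpExtension.EisensteinH1Data (κ.unitTwist (-1))
          (fun k ↦ (W.baseChange K).torsionGaloisModule ((p : ℤ) ^ k)) t hm)
        (_hy : (W.eisensteinDVRSetting (κ.unitTwist (-1)) hm S hpS hbad L hL hLS jbar' cd Dd fs).SatisfiesH)
        (κKS : (W.eisensteinDVRSetting (κ.unitTwist (-1)) hm S hpS hbad L hL hLS jbar' cd Dd fs).KolyvaginSystem),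
        (W.eisensteinDVRSetting (κ.unitTwist (-1)) hm S hpS hbad L hL hLS jbar' cd Dd fs).LargePrimes ∧
        κKS.one ≠ 0 ∧
        ∀ k, κKS.one k = ctrlLevel (W.baseChange K) κ γ hm t ht I D hyp.topGenerator hyp.noPTorsion z k

/-- INPUT 1 — the Poitou–Tate named fact (binder). -/
abbrev Stmt.poitouTate : Prop :=
  ∀ (K : Type) [Field K] [NumberField K], poitouTate_selmerStructure_duality K

set_option synthInstance.maxHeartbeats 80000 in
/-- INPUT 2 — **H.4 at the places of `S`** (`S` containing the places above `p`, contained in the places above `pN`, `Aut(K/ℚ)`-stable)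
for the instantiated H.4 data (canonical conjugation datum), `m ≫ 0` depending on `S` only.  The binders after `m` are exactly the data/identities exported by `exists_eisensteinSettingData_satisfiesH_of_thm413Hypotheses`. -/
abbrev Stmt.h4AtS : Prop :=
  ∀ (N : ℕ) [NeZero N] (W : WeierstrassCurve ℚ) [W.IsGloballyMinimal] (K : Type) [Field K] [NumberField K]
    (p : ℕ) [Fact p.Prime] (κ : ZpExtension K p) (γ : Field.absoluteGaloisGroup K)
    (hyp : CastellaGrossiLeeSkinner2022.Thm413Hypotheses N W K p κ γ),
    W.HasIrreducibleModPGaloisRep p → (W.baseChange K).HasIrreducibleModPGaloisRep p →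
    haveI := hyp.isElliptic
    ∀ (S : Finset (HeightOneSpectrum (𝓞 K)))
      (hpS : ∀ v, ((p : ℕ) : 𝓞 K) ∈ v.asIdeal → v ∈ S)
      (hbad : ∀ v, v ∉ S → ((p : ℕ) : 𝓞 K) ∉ v.asIdeal → (W.baseChange K).HasGoodReductionAt v),
    (∀ v ∈ S, ((p : ℕ) : 𝓞 K) ∈ v.asIdeal ∨ ((N : ℕ) : 𝓞 K) ∈ v.asIdeal) →
    (∀ (σ : K ≃ₐ[ℚ] K) (v : HeightOneSpectrum (𝓞 K)), σ • v ∈ S → v ∈ S) →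
    ∃ m₄ : ℕ, ∀ (m : ℕ) (hm : 1 ≤ m), m₄ ≤ m →
      letI := IwasawaAlgebra.isDomain_quotient_X_pow_add_C p hm
      letI := IwasawaAlgebra.isDiscreteValuationRing_quotient_X_pow_add_C p hm
      haveI := IwasawaAlgebra.EisensteinCoeff.isLocalRing_succ p hm
      letI := IwasawaAlgebra.EisensteinCoeff.algebraOfSpecSucc p m
      haveI := W.isScalarTower_algebraOfSpecSucc (K := K) (p := p) (m := m)
      letI := W.residueModuleSucc (K := K) (p := p) hm
      ∀ (L : Set (HeightOneSpectrum (𝓞 K)))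
        (hL : L ⊆ (W.eisensteinTower (κ.unitTwist (-1)) hm).degreeTwoPrimes p) (hLS : ∀ v ∈ L, v ∉ S)
        (c₀ : absoluteGaloisGroup ℚ) (σ : K ≃ₐ[ℚ] K) (hσ₁ : σ ≠ 1) (hσ : σ * σ = 1)
        (hτl : IsLiftOfAut σ (absGaloisTransport (K := ℚ) (L := K) c₀).toRingEquiv)
        (hτ₂ : Function.Involutive (absGaloisTransport (K := ℚ) (L := K) c₀).toRingEquiv)
        (D : ∀ k, DualityDatum p (ConjugationDatum.ofLifts σ hσ₁ hσ _ hτl hτ₂)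
          ((W.eisensteinTower (κ.unitTwist (-1)) hm).ρ k) (IwasawaAlgebra.EisensteinCoeff p m (k + 1)))
        (e : ∀ j : ℕ, geomTorsion (W.baseChange K) ((p : ℤ) ^ j) →+ geomTorsion (W.baseChange K) ((p : ℤ) ^ j) →+
          MuCarrier K (p ^ j))
        (log : ∀ j : ℕ, MuCarrier K (p ^ j) →+ ZMod (p ^ j)),
        IsComplexConjugation (Rat.castHom ℝ) c₀ →
        (∀ x, (ConjugationDatum.ofLifts σ hσ₁ hσ _ hτl hτ₂).τ x = absGaloisTransport (K := ℚ) (L := K) c₀ x) →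
        (∀ k, (D k).e = ZpExtension.eisensteinDualityForm hm (k + 1)
          (conjPairing (e (k + 1)) ((ConjugationDatum.ofLifts σ hσ₁ hσ _ hτl hτ₂).isLift.torsionMap W _)
            (log (k + 1)))) →
        (∀ k (x y : EisensteinLevel p m (fun j ↦ geomTorsion (W.baseChange K) ((p : ℤ) ^ j)) (k + 1 + 1)),
          IwasawaAlgebra.EisensteinCoeff.reduce p m (Nat.le_succ (k + 1)) ((D (k + 1)).e x y) =
            (D k).e ((W.eisensteinTower (κ.unitTwist (-1)) hm).red k x) ((W.eisensteinTower (κ.unitTwist (-1)) hm).red k y)) →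
        (∀ j a, e j a a = 0) →
        (∀ j (g : absoluteGaloisGroup K) a b, e j (g • a) (g • b) = mu K (p ^ j) g (e j a b)) →
        (∀ j a b, e j ((ConjugationDatum.ofLifts σ hσ₁ hσ _ hτl hτ₂).isLift.torsionMap W _ a)
          ((ConjugationDatum.ofLifts σ hσ₁ hσ _ hτl hτ₂).isLift.torsionMap W _ b) = -e j a b) →
        (∀ j (a : geomTorsion (W.baseChange K) ((p : ℤ) ^ j)),
          (ConjugationDatum.ofLifts σ hσ₁ hσ _ hτl hτ₂).isLift.torsionMap W _
            ((ConjugationDatum.ofLifts σ hσ₁ hσ _ hτl hτ₂).isLift.torsionMap W _ a) = a) →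
        (∀ j, Function.Bijective (log j)) →
        (∀ j (g : absoluteGaloisGroup K) ξ, log j (mu K (p ^ j) g ξ) = cyclotomicCharacterModPow K p j g * log j ξ) →
        ∀ k, ∀ v ∈ S, (D k).IsSelfOrthogonalAt
          (W.eisensteinTowerTriple (κ.unitTwist (-1)) hm S hpS hbad L hL hLS k).cond v

set_option synthInstance.maxHeartbeats 80000 in
/-- INPUT 2′ — **(Exact) at the places `v ∣ p`** in the LIMIT (memo HOME/p1/H4-EXACT-AT-P-PLAN §1(d)(f); (ANN-SAT) x9-p1-w4 g8 ⊕
(EXACT-REP) x9-p1-w2 g8): same binders as `Stmt.h4AtS`, conclusion = the two (Exact) hypotheses of w8's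
`Tower.levelCondition_mem_iff_forall_pairing_eq_zero` (p649469) for the `D`-indexed local towers at `v` with the strict-ordinary cores —
verbatim the `hExactY`/`hExactX` of `eisensteinTower_isSelfOrthogonalAt_of_mem` (p669585).  `Stmt.h4AtS` FOLLOWS from it
(`h4AtS_of_exactAtP`). -/
abbrev Stmt.exactAtP : Prop :=
  ∀ (N : ℕ) [NeZero N] (W : WeierstrassCurve ℚ) [W.IsGloballyMinimal] (K : Type) [Field K] [NumberField K]
    (p : ℕ) [Fact p.Prime] (κ : ZpExtension K p) (γ : Field.absoluteGaloisGroup K)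
    (hyp : CastellaGrossiLeeSkinner2022.Thm413Hypotheses N W K p κ γ),
    W.HasIrreducibleModPGaloisRep p → (W.baseChange K).HasIrreducibleModPGaloisRep p →
    haveI := hyp.isElliptic
    ∀ (S : Finset (HeightOneSpectrum (𝓞 K)))
      (hpS : ∀ v, ((p : ℕ) : 𝓞 K) ∈ v.asIdeal → v ∈ S)
      (hbad : ∀ v, v ∉ S → ((p : ℕ) : 𝓞 K) ∉ v.asIdeal → (W.baseChange K).HasGoodReductionAt v),
    (∀ v ∈ S, ((p : ℕ) : 𝓞 K) ∈ v.asIdeal ∨ ((N : ℕ) : 𝓞 K) ∈ v.asIdeal) →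
    (∀ (σ : K ≃ₐ[ℚ] K) (v : HeightOneSpectrum (𝓞 K)), σ • v ∈ S → v ∈ S) →
    ∃ m₆ : ℕ, ∀ (m : ℕ) (hm : 1 ≤ m), m₆ ≤ m →
      letI := IwasawaAlgebra.isDomain_quotient_X_pow_add_C p hm
      letI := IwasawaAlgebra.isDiscreteValuationRing_quotient_X_pow_add_C p hm
      haveI := IwasawaAlgebra.EisensteinCoeff.isLocalRing_succ p hm
      letI := IwasawaAlgebra.EisensteinCoeff.algebraOfSpecSucc p m
      haveI := W.isScalarTower_algebraOfSpecSucc (K := K) (p := p) (m := m)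
      letI := W.residueModuleSucc (K := K) (p := p) hm
      ∀ (L : Set (HeightOneSpectrum (𝓞 K)))
        (hL : L ⊆ (W.eisensteinTower (κ.unitTwist (-1)) hm).degreeTwoPrimes p) (hLS : ∀ v ∈ L, v ∉ S)
        (c₀ : absoluteGaloisGroup ℚ) (σ : K ≃ₐ[ℚ] K) (hσ₁ : σ ≠ 1) (hσ : σ * σ = 1)
        (hτl : IsLiftOfAut σ (absGaloisTransport (K := ℚ) (L := K) c₀).toRingEquiv)
        (hτ₂ : Function.Involutive (absGaloisTransport (K := ℚ) (L := K) c₀).toRingEquiv)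
        (D : ∀ k, DualityDatum p (ConjugationDatum.ofLifts σ hσ₁ hσ _ hτl hτ₂)
          ((W.eisensteinTower (κ.unitTwist (-1)) hm).ρ k) (IwasawaAlgebra.EisensteinCoeff p m (k + 1)))
        (e : ∀ j : ℕ, geomTorsion (W.baseChange K) ((p : ℤ) ^ j) →+ geomTorsion (W.baseChange K) ((p : ℤ) ^ j) →+
          MuCarrier K (p ^ j))
        (log : ∀ j : ℕ, MuCarrier K (p ^ j) →+ ZMod (p ^ j)),
        IsComplexConjugation (Rat.castHom ℝ) c₀ →
        (∀ x, (ConjugationDatum.ofLifts σ hσ₁ hσ _ hτl hτ₂).τ x = absGaloisTransport (K := ℚ) (L := K) c₀ x) →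
        (∀ k, (D k).e = ZpExtension.eisensteinDualityForm hm (k + 1)
          (conjPairing (e (k + 1)) ((ConjugationDatum.ofLifts σ hσ₁ hσ _ hτl hτ₂).isLift.torsionMap W _)
            (log (k + 1)))) →
        (∀ k (x y : EisensteinLevel p m (fun j ↦ geomTorsion (W.baseChange K) ((p : ℤ) ^ j)) (k + 1 + 1)),
          IwasawaAlgebra.EisensteinCoeff.reduce p m (Nat.le_succ (k + 1)) ((D (k + 1)).e x y) =
            (D k).e ((W.eisensteinTower (κ.unitTwist (-1)) hm).red k x) ((W.eisensteinTower (κ.unitTwist (-1)) hm).red k y)) →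
        (∀ j a, e j a a = 0) →
        (∀ j (g : absoluteGaloisGroup K) a b, e j (g • a) (g • b) = mu K (p ^ j) g (e j a b)) →
        (∀ j a b, e j ((ConjugationDatum.ofLifts σ hσ₁ hσ _ hτl hτ₂).isLift.torsionMap W _ a)
          ((ConjugationDatum.ofLifts σ hσ₁ hσ _ hτl hτ₂).isLift.torsionMap W _ b) = -e j a b) →
        (∀ j (a : geomTorsion (W.baseChange K) ((p : ℤ) ^ j)),
          (ConjugationDatum.ofLifts σ hσ₁ hσ _ hτl hτ₂).isLift.torsionMap W _
            ((ConjugationDatum.ofLifts σ hσ₁ hσ _ hτl hτ₂).isLift.torsionMap W _ a) = a) →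
        (∀ j, Function.Bijective (log j)) →
        (∀ j (g : absoluteGaloisGroup K) ξ, log j (mu K (p ^ j) g ξ) = cyclotomicCharacterModPow K p j g * log j ξ) →
        ∀ (k : ℕ) (v : HeightOneSpectrum (𝓞 K)), v ∈ S → ((p : ℕ) : 𝓞 K) ∈ v.asIdeal →
          (∀ η ∈ Tower.compatibleFamilies (H := fun j ↦ galoisCohomology (((ConjugationDatum.ofLifts σ hσ₁ hσ _ hτl hτ₂).twist ((W.eisensteinTower (κ.unitTwist (-1)) hm).ρ j)).toLocal (Sum.inr v)) 1)
              (fun j ↦ ContinuousRep.cohomologyMap (((ConjugationDatum.ofLifts σ hσ₁ hσ _ hτl hτ₂).twist ((W.eisensteinTower (κ.unitTwist (-1)) hm).ρ (j + 1))).toLocal (Sum.inr v))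
            (((ConjugationDatum.ofLifts σ hσ₁ hσ _ hτl hτ₂).twist ((W.eisensteinTower (κ.unitTwist (-1)) hm).ρ j)).toLocal (Sum.inr v)) ((W.eisensteinTower (κ.unitTwist (-1)) hm).red j).toAddMonoidHom
            continuous_of_discreteTopology (fun _ z => (W.eisensteinTower (κ.unitTwist (-1)) hm).red_equivariant j _ z) 1),
            (∀ ξ ∈ Tower.saturatedFamilies (H := fun j ↦ galoisCohomology (((W.eisensteinTower (κ.unitTwist (-1)) hm).ρ j).toLocal (Sum.inr v)) 1)
                (fun j ↦ ContinuousRep.cohomologyMap (((W.eisensteinTower (κ.unitTwist (-1)) hm).ρ (j + 1)).toLocal (Sum.inr v))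
            (((W.eisensteinTower (κ.unitTwist (-1)) hm).ρ j).toLocal (Sum.inr v)) ((W.eisensteinTower (κ.unitTwist (-1)) hm).red j).toAddMonoidHom
            continuous_of_discreteTopology (fun _ z => (W.eisensteinTower (κ.unitTwist (-1)) hm).red_equivariant j _ z) 1) p
                (fun j ↦ ((W.baseChange K).ordinaryFiltrationAt v (fun j ↦ (W.baseChange K).torsionGaloisModuleReduce p j) (fun _ _ ↦ rfl)).ordinaryCore hm (j + 1)),
              (D k).localCup (Sum.inr v) (ξ k) (η k) = 0) →
            ∃ η' : Π j, galoisCohomology (((ConjugationDatum.ofLifts σ hσ₁ hσ _ hτl hτ₂).twist ((W.eisensteinTower (κ.unitTwist (-1)) hm).ρ j)).toLocal (Sum.inr v)) 1,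
              η - p ^ (k + 1) • η' ∈ Tower.saturatedFamilies (H := fun j ↦ galoisCohomology (((ConjugationDatum.ofLifts σ hσ₁ hσ _ hτl hτ₂).twist ((W.eisensteinTower (κ.unitTwist (-1)) hm).ρ j)).toLocal (Sum.inr v)) 1)
                (fun j ↦ ContinuousRep.cohomologyMap (((ConjugationDatum.ofLifts σ hσ₁ hσ _ hτl hτ₂).twist ((W.eisensteinTower (κ.unitTwist (-1)) hm).ρ (j + 1))).toLocal (Sum.inr v))
            (((ConjugationDatum.ofLifts σ hσ₁ hσ _ hτl hτ₂).twist ((W.eisensteinTower (κ.unitTwist (-1)) hm).ρ j)).toLocal (Sum.inr v)) ((W.eisensteinTower (κ.unitTwist (-1)) hm).red j).toAddMonoidHom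
            continuous_of_discreteTopology (fun _ z => (W.eisensteinTower (κ.unitTwist (-1)) hm).red_equivariant j _ z) 1) p
                (fun j ↦ (((W.baseChange K).ordinaryFiltrationAt ((ConjugationDatum.ofLifts σ hσ₁ hσ _ hτl hτ₂).σ • v) (fun j ↦ (W.baseChange K).torsionGaloisModuleReduce p j) (fun _ _ ↦ rfl)).ordinaryCore hm (j + 1)).map
            ((ConjugationDatum.ofLifts σ hσ₁ hσ _ hτl hτ₂).transportH1 ((κ.unitTwist (-1)).eisensteinTwist ((W.baseChange K).torsionGaloisModule ((p : ℤ) ^ (j + 1))) hm (j + 1)) v))) ∧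
          (∀ ξ ∈ Tower.compatibleFamilies (H := fun j ↦ galoisCohomology (((W.eisensteinTower (κ.unitTwist (-1)) hm).ρ j).toLocal (Sum.inr v)) 1)
              (fun j ↦ ContinuousRep.cohomologyMap (((W.eisensteinTower (κ.unitTwist (-1)) hm).ρ (j + 1)).toLocal (Sum.inr v))
            (((W.eisensteinTower (κ.unitTwist (-1)) hm).ρ j).toLocal (Sum.inr v)) ((W.eisensteinTower (κ.unitTwist (-1)) hm).red j).toAddMonoidHom
            continuous_of_discreteTopology (fun _ z => (W.eisensteinTower (κ.unitTwist (-1)) hm).red_equivariant j _ z) 1),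
            (∀ η ∈ Tower.saturatedFamilies (H := fun j ↦ galoisCohomology (((ConjugationDatum.ofLifts σ hσ₁ hσ _ hτl hτ₂).twist ((W.eisensteinTower (κ.unitTwist (-1)) hm).ρ j)).toLocal (Sum.inr v)) 1)
                (fun j ↦ ContinuousRep.cohomologyMap (((ConjugationDatum.ofLifts σ hσ₁ hσ _ hτl hτ₂).twist ((W.eisensteinTower (κ.unitTwist (-1)) hm).ρ (j + 1))).toLocal (Sum.inr v))
            (((ConjugationDatum.ofLifts σ hσ₁ hσ _ hτl hτ₂).twist ((W.eisensteinTower (κ.unitTwist (-1)) hm).ρ j)).toLocal (Sum.inr v)) ((W.eisensteinTower (κ.unitTwist (-1)) hm).red j).toAddMonoidHom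
            continuous_of_discreteTopology (fun _ z => (W.eisensteinTower (κ.unitTwist (-1)) hm).red_equivariant j _ z) 1) p
                (fun j ↦ (((W.baseChange K).ordinaryFiltrationAt ((ConjugationDatum.ofLifts σ hσ₁ hσ _ hτl hτ₂).σ • v) (fun j ↦ (W.baseChange K).torsionGaloisModuleReduce p j) (fun _ _ ↦ rfl)).ordinaryCore hm (j + 1)).map
            ((ConjugationDatum.ofLifts σ hσ₁ hσ _ hτl hτ₂).transportH1 ((κ.unitTwist (-1)).eisensteinTwist ((W.baseChange K).torsionGaloisModule ((p : ℤ) ^ (j + 1))) hm (j + 1)) v)),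
              (D k).localCup (Sum.inr v) (ξ k) (η k) = 0) →
            ∃ ξ' : Π j, galoisCohomology (((W.eisensteinTower (κ.unitTwist (-1)) hm).ρ j).toLocal (Sum.inr v)) 1,
              ξ - p ^ (k + 1) • ξ' ∈ Tower.saturatedFamilies (H := fun j ↦ galoisCohomology (((W.eisensteinTower (κ.unitTwist (-1)) hm).ρ j).toLocal (Sum.inr v)) 1)
                (fun j ↦ ContinuousRep.cohomologyMap (((W.eisensteinTower (κ.unitTwist (-1)) hm).ρ (j + 1)).toLocal (Sum.inr v))
            (((W.eisensteinTower (κ.unitTwist (-1)) hm).ρ j).toLocal (Sum.inr v)) ((W.eisensteinTower (κ.unitTwist (-1)) hm).red j).toAddMonoidHom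
            continuous_of_discreteTopology (fun _ z => (W.eisensteinTower (κ.unitTwist (-1)) hm).red_equivariant j _ z) 1) p
                (fun j ↦ ((W.baseChange K).ordinaryFiltrationAt v (fun j ↦ (W.baseChange K).torsionGaloisModuleReduce p j) (fun _ _ ↦ rfl)).ordinaryCore hm (j + 1)))


set_option synthInstance.maxHeartbeats 80000 in
/-- INPUT 3 — **H.5(b) at the places of `S`** for the same data (pins `π`, `jbar′` arbitrary), `m ≫ 0` allowed. -/
abbrev Stmt.h5bAtS : Prop :=
  ∀ (N : ℕ) [NeZero N] (W : WeierstrassCurve ℚ) [W.IsGloballyMinimal] (K : Type) [Field K] [NumberField K]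
    (p : ℕ) [Fact p.Prime] (κ : ZpExtension K p) (γ : Field.absoluteGaloisGroup K)
    (hyp : CastellaGrossiLeeSkinner2022.Thm413Hypotheses N W K p κ γ),
    W.HasIrreducibleModPGaloisRep p → (W.baseChange K).HasIrreducibleModPGaloisRep p →
    haveI := hyp.isElliptic
    ∀ (S : Finset (HeightOneSpectrum (𝓞 K)))
      (hpS : ∀ v, ((p : ℕ) : 𝓞 K) ∈ v.asIdeal → v ∈ S)
      (hbad : ∀ v, v ∉ S → ((p : ℕ) : 𝓞 K) ∉ v.asIdeal → (W.baseChange K).HasGoodReductionAt v),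
    (∀ v ∈ S, ((p : ℕ) : 𝓞 K) ∈ v.asIdeal ∨ ((N : ℕ) : 𝓞 K) ∈ v.asIdeal) →
    (∀ (σ : K ≃ₐ[ℚ] K) (v : HeightOneSpectrum (𝓞 K)), σ • v ∈ S → v ∈ S) →
    ∃ m₅ : ℕ, ∀ (m : ℕ) (hm : 1 ≤ m), m₅ ≤ m →
      letI := IwasawaAlgebra.isDomain_quotient_X_pow_add_C p hm
      letI := IwasawaAlgebra.isDiscreteValuationRing_quotient_X_pow_add_C p hm
      haveI := IwasawaAlgebra.EisensteinCoeff.isLocalRing_succ p hm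
      letI := IwasawaAlgebra.EisensteinCoeff.algebraOfSpecSucc p m
      haveI := W.isScalarTower_algebraOfSpecSucc (K := K) (p := p) (m := m)
      letI := W.residueModuleSucc (K := K) (p := p) hm
      ∀ (π : ∀ v : HeightOneSpectrum (𝓞 K), TamePin v) (L : Set (HeightOneSpectrum (𝓞 K)))
        (hL : L ⊆ (W.eisensteinTower (κ.unitTwist (-1)) hm).degreeTwoPrimes p) (hLS : ∀ v ∈ L, v ∉ S)
        (jbar' : AlgebraicClosure K →+* ℂ)
        (c₀ : absoluteGaloisGroup ℚ) (σ : K ≃ₐ[ℚ] K) (hσ₁ : σ ≠ 1) (hσ : σ * σ = 1)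
        (hτl : IsLiftOfAut σ (absGaloisTransport (K := ℚ) (L := K) c₀).toRingEquiv)
        (hτ₂ : Function.Involutive (absGaloisTransport (K := ℚ) (L := K) c₀).toRingEquiv)
        (D : ∀ k, DualityDatum p (ConjugationDatum.ofLifts σ hσ₁ hσ _ hτl hτ₂)
          ((W.eisensteinTower (κ.unitTwist (-1)) hm).ρ k) (IwasawaAlgebra.EisensteinCoeff p m (k + 1)))
        (e : ∀ j : ℕ, geomTorsion (W.baseChange K) ((p : ℤ) ^ j) →+ geomTorsion (W.baseChange K) ((p : ℤ) ^ j) →+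
          MuCarrier K (p ^ j))
        (log : ∀ j : ℕ, MuCarrier K (p ^ j) →+ ZMod (p ^ j)),
        IsComplexConjugation (Rat.castHom ℝ) c₀ →
        (∀ x, (ConjugationDatum.ofLifts σ hσ₁ hσ _ hτl hτ₂).τ x = absGaloisTransport (K := ℚ) (L := K) c₀ x) →
        (∀ k, (D k).e = ZpExtension.eisensteinDualityForm hm (k + 1)
          (conjPairing (e (k + 1)) ((ConjugationDatum.ofLifts σ hσ₁ hσ _ hτl hτ₂).isLift.torsionMap W _)
            (log (k + 1)))) →
        (∀ k (x y : EisensteinLevel p m (fun j ↦ geomTorsion (W.baseChange K) ((p : ℤ) ^ j)) (k + 1 + 1)),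
          IwasawaAlgebra.EisensteinCoeff.reduce p m (Nat.le_succ (k + 1)) ((D (k + 1)).e x y) =
            (D k).e ((W.eisensteinTower (κ.unitTwist (-1)) hm).red k x) ((W.eisensteinTower (κ.unitTwist (-1)) hm).red k y)) →
        (∀ j a, e j a a = 0) →
        (∀ j (g : absoluteGaloisGroup K) a b, e j (g • a) (g • b) = mu K (p ^ j) g (e j a b)) →
        (∀ j a b, e j ((ConjugationDatum.ofLifts σ hσ₁ hσ _ hτl hτ₂).isLift.torsionMap W _ a)
          ((ConjugationDatum.ofLifts σ hσ₁ hσ _ hτl hτ₂).isLift.torsionMap W _ b) = -e j a b) →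
        (∀ j (a : geomTorsion (W.baseChange K) ((p : ℤ) ^ j)),
          (ConjugationDatum.ofLifts σ hσ₁ hσ _ hτl hτ₂).isLift.torsionMap W _
            ((ConjugationDatum.ofLifts σ hσ₁ hσ _ hτl hτ₂).isLift.torsionMap W _ a) = a) →
        (∀ j, Function.Bijective (log j)) →
        (∀ j (g : absoluteGaloisGroup K) ξ, log j (mu K (p ^ j) g ξ) = cyclotomicCharacterModPow K p j g * log j ξ) →
        ∀ k, ∀ v ∈ S,
          (((W.isQuotientBy_eisensteinDVRSetting_πbar (κ.unitTwist (-1)) hm S hpS hbad L hL hLS jbar'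
              (ConjugationDatum.ofLifts σ hσ₁ hσ _ hτl hτ₂) D
              (W.eisensteinLevelsTameFs (κ.unitTwist (-1)) hm π S hpS hbad L hL hLS)
              k).propagateStructure (W.eisensteinTowerTriple (κ.unitTwist (-1)) hm S hpS hbad L hL hLS k).cond)
              (Sum.inr (σ • v))).map
              (((W.residualTauGeomTorsion (p := p) (ConjugationDatum.ofLifts σ hσ₁ hσ _ hτl hτ₂) hm (k := k + 1)
                  k.succ_pos).thetaH1 (Sum.inr v)).comp
                ((ConjugationDatum.ofLifts σ hσ₁ hσ _ hτl hτ₂).transportH1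
                  ((W.baseChange K).torsionGaloisModule (p : ℤ)) v)) =
            ((W.isQuotientBy_eisensteinDVRSetting_πbar (κ.unitTwist (-1)) hm S hpS hbad L hL hLS jbar'
              (ConjugationDatum.ofLifts σ hσ₁ hσ _ hτl hτ₂) D
              (W.eisensteinLevelsTameFs (κ.unitTwist (-1)) hm π S hpS hbad L hL hLS)
              k).propagateStructure (W.eisensteinTowerTriple (κ.unitTwist (-1)) hm S hpS hbad L hL hLS k).cond)
              (Sum.inr v)

set_option synthInstance.maxHeartbeats 80000 in
/-- INPUT 4 — **the Kolyvagin system with the LINK**, `m ≫ 0`: the KS side chooses the place set `S` (⊇ places above `p`,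
⊆ places above `pN`, `Aut(K/ℚ)`-stable — e.g. `placesDividing K (p * N)` of (F-411)), the pins `π`, the prime set `𝓛` (off `S`,
inside the degree-two primes, containing `𝓛_{s₁}(T_𝔮) ∖ S` for the `LargePrimes` witness), the tower pin `(t, ht, I)` and
`jbar′`, and then, for ANY conjugation datum / H.4 data and any `hy`, produces `κKS` with bottom class the control image of `z`,
nonzero (the same binder prefix as the letter). -/
abbrev Stmt.ksLink : Prop :=
  ∀ (N : ℕ) [NeZero N] (W : WeierstrassCurve ℚ) [W.IsGloballyMinimal] (K : Type) [Field K] [NumberField K]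
    (p : ℕ) [Fact p.Prime] (κ : ZpExtension K p) (γ : Field.absoluteGaloisGroup K)
    (jbar : AlgebraicClosure K →+* ℂ) (hyp : CastellaGrossiLeeSkinner2022.Thm413Hypotheses N W K p κ γ),
    ¬ W.HasCM → W.HasIrreducibleModPGaloisRep p → (W.baseChange K).HasIrreducibleModPGaloisRep p →
    MastellaZerman2026.HasPadicScalarImage W p → SatisfiesHeegnerHypothesis p K →
    p ∣ NumberField.classNumber K →
    ∀ (D : (W.baseChange K).LambdaAdicSelmerData κ γ)
      (C : CastellaGrossiLeeSkinner2022.StabilizedHeegnerData N W K κ jbar)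
      (X : (W.baseChange K).SelmerDualData κ γ) (z : D.S),
    (∀ (k : ℕ) (hk : C.depth < k), D.proj k z ∈ CastellaGrossiLeeSkinner2022.stabilizedClassLayer C k hk) →
    CastellaGrossiLeeSkinner2022.stabilizedHeegnerModule D C = Submodule.span (IwasawaAlgebra p) {z} →
    Module.Finite (IwasawaAlgebra p) D.S → Module.Finite (IwasawaAlgebra p) X.X →
    Module.IsTorsion (IwasawaAlgebra p) (D.S ⧸ CastellaGrossiLeeSkinner2022.stabilizedHeegnerModule D C) →
    haveI := hyp.isElliptic
    ∃ (S : Finset (HeightOneSpectrum (𝓞 K)))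
      (hpS : ∀ v, ((p : ℕ) : 𝓞 K) ∈ v.asIdeal → v ∈ S)
      (hbad : ∀ v, v ∉ S → ((p : ℕ) : 𝓞 K) ∉ v.asIdeal → (W.baseChange K).HasGoodReductionAt v)
      (_hSN : ∀ v ∈ S, ((p : ℕ) : 𝓞 K) ∈ v.asIdeal ∨ ((N : ℕ) : 𝓞 K) ∈ v.asIdeal)
      (_hSσ : ∀ (σ : K ≃ₐ[ℚ] K) (v : HeightOneSpectrum (𝓞 K)), σ • v ∈ S → v ∈ S)
      (m₁ : ℕ), ∀ (m : ℕ) (hm : 1 ≤ m), m₁ ≤ m →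
      letI := IwasawaAlgebra.isDomain_quotient_X_pow_add_C p hm
      letI := IwasawaAlgebra.isDiscreteValuationRing_quotient_X_pow_add_C p hm
      haveI := IwasawaAlgebra.EisensteinCoeff.isLocalRing_succ p hm
      letI := IwasawaAlgebra.EisensteinCoeff.algebraOfSpecSucc p m
      haveI := W.isScalarTower_algebraOfSpecSucc (K := K) (p := p) (m := m)
      letI := W.residueModuleSucc (K := K) (p := p) hm
      ∃ (π : ∀ v : HeightOneSpectrum (𝓞 K), TamePin v) (L : Set (HeightOneSpectrum (𝓞 K)))
        (hL : L ⊆ (W.eisensteinTower (κ.unitTwist (-1)) hm).degreeTwoPrimes p) (hLS : ∀ v ∈ L, v ∉ S)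
        (s₁ : ℕ) (_hsub : ∀ v ∈ (W.eisensteinTower (κ.unitTwist (-1)) hm).kolyvaginPrimes p s₁, v ∉ S → v ∈ L)
        (t : ∀ k, ((W.baseChange K).torsionGaloisModule ((p : ℤ) ^ (k + 1))).toContRepresentation →ⁱL
          ((W.baseChange K).torsionGaloisModule ((p : ℤ) ^ k)).toContRepresentation)
        (ht : ∀ k (P : geomTorsion (W.baseChange K) ((p : ℤ) ^ (k + 1))),
          t k P = (W.baseChange K).geomTorsionReduce p k P)
        (I : ZpExtension.EisensteinH1Data (κ.unitTwist (-1))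
          (fun k ↦ (W.baseChange K).torsionGaloisModule ((p : ℤ) ^ k)) t hm)
        (jbar' : AlgebraicClosure K →+* ℂ),
        ∀ (cd : ConjugationDatum K)
          (Dd : ∀ k, DualityDatum p cd ((W.eisensteinTower (κ.unitTwist (-1)) hm).ρ k)
            (IwasawaAlgebra.EisensteinCoeff p m (k + 1)))
          (hy : (W.eisensteinDVRSettingLevelsTame (κ.unitTwist (-1)) hm π S hpS hbad L hL hLS jbar' cd Dd).SatisfiesH),
          ∃ κKS : (W.eisensteinDVRSettingLevelsTame (κ.unitTwist (-1)) hm π S hpS hbad L hL hLS jbar' cd Dd).KolyvaginSystem,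
            κKS.one ≠ 0 ∧
            ∀ k, κKS.one k = ctrlLevel (W.baseChange K) κ γ hm t ht I D hyp.topGenerator hyp.noPTorsion z k

set_option synthInstance.maxHeartbeats 80000 in
set_option maxHeartbeats 1600000 in
/-- **INPUT 2 from INPUT 2′**: `Stmt.h4AtS` (H.4 at every `v ∈ S`) follows from the (Exact) statement at the places `v ∣ p`
(`Stmt.exactAtP`) and the Poitou–Tate binder — by `eisensteinTower_isSelfOrthogonalAt_of_mem` (p669585) +
`eisensteinTower_orthogonal_twistedFil_of_e_eq` (p670038) at `v ∣ p`, and `eisensteinTower_isSelfOrthogonalAt_of_mem_of_not_mem_ofLifts`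
(p667328) + (N1) p657002 + `decomp_not_le_kerSubgroup_of_mem_or_mem` at `v ∤ p` (threshold `max_v 2N_v`). -/
theorem h4AtS_of_exactAtP (hPT : Stmt.poitouTate) (HE : Stmt.exactAtP) : Stmt.h4AtS := by
  intro N _ W _ K _ _ p _ κ γ hyp hirr hirrK
  haveI := hyp.isElliptic
  intro S hpS hbad hSN hSσ
  classical
  have hK : IsImaginaryQuadratic K := hyp.isImaginaryQuadratic
  have hanti : (κ.unitTwist (-1)).IsAnticyclotomic := hyp.anticyclotomic.unitTwist (-1)
  have hHeeg : SatisfiesHeegnerHypothesis N K := hyp.heegner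
  have hN0 : N ≠ 0 := NeZero.ne N
  have hdec : ∀ v ∈ S, ((p : ℕ) : 𝓞 K) ∉ v.asIdeal → ¬ (GreenbergSelmer.decomp v ≤ (κ.unitTwist (-1)).kerSubgroup) :=
    fun v hv _ ↦ ZpExtension.decomp_not_le_kerSubgroup_of_mem_or_mem hK (κ.unitTwist (-1)) hanti hHeeg hN0 hSN v hv
  -- the (N1) bounds at the places of `S` prime to `p` (dummy elsewhere)
  have hvN : ∀ v ∈ S, ((p : ℕ) : 𝓞 K) ∉ v.asIdeal →
      ∃ Nv : ℕ, 1 ≤ Nv ∧ ∀ (m : ℕ) (hm : 1 ≤ m), 2 * Nv < m → ∀ (j : ℕ)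
        (x : galoisCohomology (GaloisRep.toLocal v
          ((κ.unitTwist (-1)).eisensteinTwist ((W.baseChange K).torsionGaloisModule ((p : ℤ) ^ j)) hm j)) 1), p ^ (8 * Nv) • x = 0 :=
    fun v hvS hpv ↦ exists_forall_pow_smul_galoisCohomology_one_toLocal_eq_zero_uniform v (W.baseChange K) (κ.unitTwist (-1)) hpv
      (hdec v hvS hpv)
  choose! Nv hNv using hvN
  obtain ⟨m₆, h6⟩ := HE N W K p κ γ hyp hirr hirrK S hpS hbad hSN hSσ
  refine ⟨max (S.sup (fun v ↦ 2 * Nv v) + 1) m₆, fun m hm hle L hL hLS c₀ σ hσ₁ hσ hτl hτ₂ D e log hc₀ hτ hDe he_red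
    h4' h5' h6' h7' h8' h9' k v hvS ↦ ?_⟩
  have hm6 : m₆ ≤ m := le_trans (le_max_right _ _) hle
  have hsup : S.sup (fun v ↦ 2 * Nv v) < m :=
    Nat.lt_of_lt_of_le (Nat.lt_succ_self _) (le_trans (le_max_left _ _) hle)
  letI := IwasawaAlgebra.isDomain_quotient_X_pow_add_C p hm
  letI := IwasawaAlgebra.isDiscreteValuationRing_quotient_X_pow_add_C p hm
  haveI := IwasawaAlgebra.EisensteinCoeff.isLocalRing_succ p hm
  letI := IwasawaAlgebra.EisensteinCoeff.algebraOfSpecSucc p m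
  haveI := W.isScalarTower_algebraOfSpecSucc (K := K) (p := p) (m := m)
  letI := W.residueModuleSucc (K := K) (p := p) hm
  by_cases hpv : ((p : ℕ) : 𝓞 K) ∈ v.asIdeal
  · -- `v ∣ p`: (Exact) + module isotropy
    have hσpv : ((p : ℕ) : 𝓞 K) ∈ ((ConjugationDatum.ofLifts σ hσ₁ hσ _ hτl hτ₂).σ • v).asIdeal :=
      (WeierstrassCurve.natCast_mem_smul_asIdeal_iff (K := K) (p := p) σ v).2 hpv
    obtain ⟨hEY, hEX⟩ := h6 m hm hm6 L hL hLS c₀ σ hσ₁ hσ hτl hτ₂ D e log hc₀ hτ hDe he_red h4' h5' h6' h7' h8' h9' k v hvS hpv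
    exact W.eisensteinTower_isSelfOrthogonalAt_of_mem (κ.unitTwist (-1)) hm S hpS hbad L hL hLS (ConjugationDatum.ofLifts σ hσ₁ hσ _ hτl hτ₂) D he_red (hPT K) k hpv hσpv
      (W.eisensteinTower_orthogonal_twistedFil_of_e_eq (κ.unitTwist (-1)) hm σ hσ₁ hσ _ hτl hτ₂ hyp.ordinary D e log hDe h4' h8' h7' hpv)
      hEY hEX
  · -- `v ∤ p`: the torsion descent with the (N1) bounds at `v` and `σ•v`
    have hσvS : σ • v ∈ S := hSσ σ _ (by rwa [smul_smul, hσ, one_smul])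
    have hσpv : ((p : ℕ) : 𝓞 K) ∉ (σ • v).asIdeal := fun h ↦
      hpv ((WeierstrassCurve.natCast_mem_smul_asIdeal_iff (K := K) (p := p) σ v).1 h)
    have h2v : 2 * Nv v < m := lt_of_le_of_lt (Finset.le_sup (f := fun v ↦ 2 * Nv v) hvS) hsup
    have h2σv : 2 * Nv (σ • v) < m := lt_of_le_of_lt (Finset.le_sup (f := fun v ↦ 2 * Nv v) hσvS) hsup
    exact W.eisensteinTower_isSelfOrthogonalAt_of_mem_of_not_mem_ofLifts (κ.unitTwist (-1)) hm S hpS hbad L hL hLS σ hσ₁ hσ _ hτl hτ₂ D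
      he_red (hPT K) k hpv hvS hσpv hσvS
      (fun j x ↦ (hNv v hvS hpv).2 m hm h2v (j + 1) x) (fun j x ↦ (hNv (σ • v) hσvS hσpv).2 m hm h2σv (j + 1) x)

set_option synthInstance.maxHeartbeats 80000 in
set_option maxHeartbeats 1600000 in
/-- **STUB A from the four inputs** (the D1 `obtain` chain). -/
theorem howardInputs_of_clauses (hPT : Stmt.poitouTate) (H4 : Stmt.h4AtS) (H5 : Stmt.h5bAtS)
    (KS : Stmt.ksLink) : Stmt.howardInputs := by
  intro N _ W _ K _ _ p _ κ γ jbar hyp hCM hirr hirrK hsc hHp hhK D C X z hz hcyc hfinS hfinX htor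
  haveI := hyp.isElliptic
  -- the KS side's set of places `S` (above `p` and `N`, `Aut(K/ℚ)`-stable) and its threshold `m₁`
  obtain ⟨S, hpS, hbad, hSN, hSσ, m₁, hKS⟩ :=
    KS N W K p κ γ jbar hyp hCM hirr hirrK hsc hHp hhK D C X z hz hcyc hfinS hfinX htor
  obtain ⟨m₄, hH4⟩ := H4 N W K p κ γ hyp hirr hirrK S hpS hbad hSN hSσ
  obtain ⟨m₅, hH5⟩ := H5 N W K p κ γ hyp hirr hirrK S hpS hbad hSN hSσ
  refine ⟨max (max m₁ m₄) m₅, fun m hm hle ↦ ?_⟩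
  have hm1 : m₁ ≤ m := le_trans ((le_max_left _ _).trans (le_max_left _ _)) hle
  have hm4 : m₄ ≤ m := le_trans ((le_max_right _ _).trans (le_max_left _ _)) hle
  have hm5 : m₅ ≤ m := le_trans (le_max_right _ _) hle
  letI := IwasawaAlgebra.isDomain_quotient_X_pow_add_C p hm
  letI := IwasawaAlgebra.isDiscreteValuationRing_quotient_X_pow_add_C p hm
  haveI := IwasawaAlgebra.EisensteinCoeff.isLocalRing_succ p hm
  letI := IwasawaAlgebra.EisensteinCoeff.algebraOfSpecSucc p m
  haveI := W.isScalarTower_algebraOfSpecSucc (K := K) (p := p) (m := m)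
  letI := W.residueModuleSucc (K := K) (p := p) hm
  -- the KS side's choices at `m`
  obtain ⟨π, L, hL, hLS, s₁, hsub, t, ht, I, jbar', hKSm⟩ := hKS m hm hm1
  -- D1: conjugation datum, H.4 data, `SatisfiesH` modulo the `v ∈ S` clauses
  obtain ⟨c₀, σ, hσ₁, hσ, hτl, hτ₂, Dd, e, log, hc₀, hτ, hDe, he_red, h4', h5', h6', h7', h8', h9', hyOf⟩ :=
    HeegnerMuPartHowardSettingERed.exists_eisensteinSettingData_satisfiesH_eRed_of_thm413Hypotheses hyp hirr hirrK (hPT K)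
      (-1) hm π S hpS hbad hSσ L hL hLS jbar'
  have hfin4 := hH4 m hm hm4 L hL hLS c₀ σ hσ₁ hσ hτl hτ₂ Dd e log hc₀ hτ hDe he_red h4' h5' h6' h7' h8' h9'
  have hfin5b := hH5 m hm hm5 π L hL hLS jbar' c₀ σ hσ₁ hσ hτl hτ₂ Dd e log hc₀ hτ hDe he_red h4' h5' h6' h7' h8' h9'
  have hy := hyOf hfin4 hfin5b
  obtain ⟨κKS, hone, hlink⟩ := hKSm _ Dd hy
  have hLP := W.eisensteinDVRSetting_largePrimes (κ.unitTwist (-1)) hm S hpS hbad L hL hLS jbar' _ Dd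
    (W.eisensteinLevelsTameFs (κ.unitTwist (-1)) hm π S hpS hbad L hL hLS) hsub
  exact ⟨S, hpS, hbad, L, hL, hLS, jbar', _, Dd, W.eisensteinLevelsTameFs (κ.unitTwist (-1)) hm π S hpS hbad L hL hLS,
    t, ht, I, hy, κKS, hLP, hone, hlink⟩

/-- **STUB A from (PT), (Exact at v ∣ p), H.5(b) at S, and the Kolyvagin-system clause** (v3 census form). -/
theorem howardInputs_of_exactAtP (hPT : Stmt.poitouTate) (HE : Stmt.exactAtP) (H5 : Stmt.h5bAtS)
    (KS : Stmt.ksLink) : Stmt.howardInputs :=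
  howardInputs_of_clauses hPT (h4AtS_of_exactAtP hPT HE) H5 KS

end Summit.BirchSwinnertonDyer.BirchSwinnertonDyer.Cruxes.MuInequalityCoherentPair.D1Assembly

end
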